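/-
COR-CM (cell pub-hodgecm2, stage 2 of the Hodge ladder) — count-neutral KERNEL COMBINATORICS «the abelian datum»
(seat prover-pub-hodgecm2-b23-g39-0, binder prover b23, gen 39; claim ABELIAN-DATUM D1, HOME/INBOX.md).  Theorems only (finite abelian
group theory over Mathlib + the cyclotomic conjugation lemma); no geometry, no named fact, nothing asserted; `Interfaces.lean` (C1), every
E term, B01 and `Transposition/*` are untouched.
HONEST FRAMING (COORDINATOR RULING — HODGE FRAMING CORRECTION, 2026-08-21T11:55:35Z): `HC_CM` is NOT proved, here or anywhere in the
tree; this file is pure group theory and produces no period.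
T5: n/a-class — no HC-level conclusion in this file; checker: self (prover-pub-hodgecm2-b23-g39-0), 2026-08-22.
-/
import Summits.HodgeConjecture.CorCM.FaceCensusGroupDictionary
import Mathlib.LinearAlgebra.FreeModule.ModN
import Mathlib.LinearAlgebra.FreeModule.Basic
import Mathlib.LinearAlgebra.Dual.Lemmas
import Mathlib.Algebra.Field.ZMod
import Mathlib.NumberTheory.Cyclotomic.Gal
import Mathlib.GroupTheory.SpecificGroups.Cyclic
import HarnessLib

/-!
# The abelian datum: an `Aut`-datum `Aut(K) ≃ ℤ/2 × A` exists iff complex conjugation is not a square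

The slice transports of this seat (`CorCM/FaceCensusOddSliceTransport.lean` `autDatum`; `Census/OddSliceFaceTransport.lean`
`exists_faceSet_oddSliceFamily_aut`, gen 36; `Census/EvenSliceFaceTransport.lean` `exists_faceSet_evenSliceSquares_aut`, gen 37) take as
INPUT an `Aut`-datum: a bijection `ε : Aut(K) ≃ ℤ/2 × A`, multiplicative-to-additive, carrying the automorphism `c` that induces complex
conjugation at a base embedding to `(1, 0)`.  This file says exactly when such a datum exists and builds it:

* §1 GROUP THEORY.  In a commutative group a NON-SQUARE is detected by an additive character of order two
  (`exists_addChar_of_not_isSquare` — the quotient `G/G²` is an `𝔽₂`-vector space, Mathlib `ModN` + `Module.Projective.exists_dual_eq_one`);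
  an involution of a group of order `2m`, `m` odd, is never a square (`not_isSquare_of_odd`); the subgroup of an involution is `{1, c}`
  (`eq_one_or_eq_of_mem_zpowers`) with `|G/⟨c⟩|·2 = |G|` (`card_quotient_zpowers_mul_two`).
* §2 THE DATUM FROM A PRESENTATION (`exists_datum_of_presentation`, any group): a detecting character `χ : G → ℤ/2` (`χ c = 1`) and ANY
  presentation `π : G ↠ A` of `G/⟨c⟩` (additive on products, `π c = 0`, kernel `{1, c}`) give the datum `ε = (χ, π) : G ≃ ℤ/2 × A` with
  `ε c = (1, 0)`; conversely a datum forces `c ∉ G²` (`not_isSquare_of_datum`).  For commutative `G` the canonical presentation is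
  `G → G/⟨c⟩` (`presentation_quotient`), so: **a datum exists iff `c` is a non-square involution** (`exists_datum_iff_not_isSquare`).
* §3 FIELDS.  For a Galois number field `F` with COMMUTATIVE `Aut(F)`: `exists_autDatum_of_not_isSquare` (presentation form, the one the
  census instances use) and the automatic odd case `not_isSquare_conjAut_of_odd` (`[F:ℚ] = 2m`, `m` odd).  For a CYCLOTOMIC field the
  conjugation automorphism at any complex embedding is `ζ ↦ ζ⁻¹`, i.e. `−1` under Mathlib's `autEquivPow` (`autEquivPow_conjAut`), and
  `Aut` is commutative (`aut_mul_comm_of_isCyclotomicExtension`) — so for `ℚ(ζ_N)` the datum exists iff `−1` is a non-square unit mod `N`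
  (`4 ∣ N`, or a prime `≡ 3 (mod 4)` divides `N`), a `decide` away in the form `∀ r : (ZMod N)ˣ, r * r ≠ -1`
  (`not_isSquare_conjAut_of_isCyclotomicExtension`).
  (Dictionary, not used below: for abelian `F`, `c ∉ Aut(F)²` iff `F` has an imaginary quadratic subfield.)

The face theorems built on the datum are the sequel `CorCM/FaceAbelianSlices.lean`; `HC_CM` is NOT proved, no period is produced.

References: [cite: Washington1997, Thm. 2.5] (`Gal(ℚ(ζ_N)/ℚ) = (ℤ/N)ˣ`, complex conjugation `= −1`); [cite: Shimura1998, §8.1 (p. 62)].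
-/

noncomputable section

open NumberField NumberField.ComplexEmbedding

namespace Summit.HodgeConjecture.CorCM.FaceAbelian

/-! ## §1 Group theory: non-squares, involutions -/

section GroupTheory

variable {G : Type*} [CommGroup G]

/-- **In a commutative group a non-square is detected by an additive character of order two** (`G/G²` is an `𝔽₂`-vector space and
linear functionals separate points). [folklore] -/
theorem exists_addChar_of_not_isSquare {c : G} (hc : ¬ IsSquare c) :
    ∃ χ : Additive G →+ ZMod 2, χ (Additive.ofMul c) = 1 := by
  set a : Additive G := Additive.ofMul c with ha_def
  have ha : ModN.mkQ 2 a ≠ 0 := by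
    intro h
    have hmem : a ∈ LinearMap.range (LinearMap.lsmul ℤ (Additive G) (2 : ℤ)) :=
      (Submodule.Quotient.mk_eq_zero _).mp h
    obtain ⟨y, hy⟩ := hmem
    apply hc
    refine ⟨Additive.toMul y, ?_⟩
    have h2 : (2 : ℤ) • y = a := hy
    rw [two_zsmul] at h2
    have := congrArg Additive.toMul h2
    simpa [a] using this.symm
  obtain ⟨f, hf⟩ := Module.Projective.exists_dual_eq_one (ZMod 2) ha
  exact ⟨f.toAddMonoidHom.comp (ModN.mkQ 2), by simpa using hf⟩

/-- The subgroup generated by an involution `c` is `{1, c}`. [folklore] -/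
theorem eq_one_or_eq_of_mem_zpowers {c : G} (hc2 : c * c = 1) {x : G} (hx : x ∈ Subgroup.zpowers c) : x = 1 ∨ x = c := by
  obtain ⟨k, rfl⟩ := Subgroup.mem_zpowers_iff.mp hx
  have hc2' : c ^ (2 : ℤ) = 1 := by rw [zpow_two]; exact hc2
  obtain ⟨j, rfl | rfl⟩ := Int.even_or_odd' k
  · left; rw [zpow_mul, hc2', one_zpow]
  · right; rw [zpow_add, zpow_mul, hc2', one_zpow, one_mul, zpow_one]

/-- `|G/⟨c⟩| · 2 = |G|` for an involution `c ≠ 1`. [folklore] -/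
theorem card_quotient_zpowers_mul_two [Finite G] {c : G} (hc2 : c * c = 1) (hc1 : c ≠ 1) :
    Nat.card (G ⧸ Subgroup.zpowers c) * 2 = Nat.card G := by
  have ho : orderOf c = 2 := orderOf_eq_prime (by rw [pow_two]; exact hc2) hc1
  have h := (Subgroup.zpowers c).card_eq_card_quotient_mul_card_subgroup
  rw [Nat.card_zpowers, ho] at h
  exact h.symm

omit [CommGroup G] in
/-- **An involution of a group of order `2m`, `m` odd, is not a square** (a square root would have order `4`). [folklore] -/
theorem not_isSquare_of_odd {G : Type*} [Group G] [Finite G] {c : G} (hc2 : c * c = 1) (hc1 : c ≠ 1) {m : ℕ} (hm : Odd m)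
    (hG : Nat.card G = 2 * m) : ¬ IsSquare c := by
  rintro ⟨r, hr⟩
  have h4 : r ^ 4 = 1 := by
    rw [show (4 : ℕ) = 2 + 2 from rfl, pow_add, pow_two, ← hr, hc2]
  have hr2 : r ^ 2 ≠ 1 := by rw [pow_two, ← hr]; exact hc1
  have ho : orderOf r = 4 := by
    have hdvd : orderOf r ∣ 2 ^ 2 := orderOf_dvd_of_pow_eq_one h4
    have hndvd : ¬ orderOf r ∣ 2 := fun h => hr2 (orderOf_dvd_iff_pow_eq_one.mp h)
    obtain ⟨k, hk, hk'⟩ := (Nat.dvd_prime_pow Nat.prime_two).mp hdvd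
    have hk2 : k = 2 := by
      by_contra hne
      apply hndvd
      rw [hk']
      calc 2 ^ k ∣ 2 ^ 1 := Nat.pow_dvd_pow 2 (by omega)
        _ = 2 := pow_one 2
    rw [hk', hk2]; norm_num
  have hdvd : orderOf r ∣ Nat.card G := orderOf_dvd_natCard r
  rw [ho, hG] at hdvd
  exact hm.not_two_dvd_nat (Nat.dvd_of_mul_dvd_mul_left (by norm_num : 0 < 2) (show 2 * 2 ∣ 2 * m from hdvd))

end GroupTheory

/-! ## §2 The datum from a presentation of `G/⟨c⟩` -/

section Datum

variable {G : Type*} [Group G] {A : Type*} [AddCommGroup A]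

/-- **The datum from a detecting character and a presentation.**  `χ : G → ℤ/2` additive on products with `χ c = 1`, `π : G → A`
additive on products with `π c = 0`, kernel `{1, c}` and onto: then `g ↦ (χ g, π g)` is a bijection `G ≃ ℤ/2 × A`, additive on products,
carrying `c` to `(1, 0)`. [folklore] -/
theorem exists_datum_of_presentation (c : G) (χ : G → ZMod 2) (hχ : ∀ g h, χ (g * h) = χ g + χ h) (hχc : χ c = 1)
    (π : G → A) (hπ : ∀ g h, π (g * h) = π g + π h) (hπc : π c = 0) (hker : ∀ g, π g = 0 → g = 1 ∨ g = c)
    (hsurj : Function.Surjective π) :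
    ∃ ε : G ≃ ZMod 2 × A, (∀ g h, ε (g * h) = ε g + ε h) ∧ ε c = (1, 0) := by
  have hχ1 : χ 1 = 0 := by
    have h := hχ 1 1
    rw [one_mul] at h
    have h2 : χ 1 + χ 1 - χ 1 = χ 1 - χ 1 := by rw [← h]
    simpa using h2
  have hπ1 : π 1 = 0 := by
    have h := hπ 1 1
    rw [one_mul] at h
    have h2 : π 1 + π 1 - π 1 = π 1 - π 1 := by rw [← h]
    simpa using h2
  have hχinv : ∀ g, χ g⁻¹ = - χ g := fun g => by
    have h := hχ g⁻¹ g
    rw [inv_mul_cancel, hχ1] at h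
    exact eq_neg_of_add_eq_zero_left h.symm
  have hπinv : ∀ g, π g⁻¹ = - π g := fun g => by
    have h := hπ g⁻¹ g
    rw [inv_mul_cancel, hπ1] at h
    exact eq_neg_of_add_eq_zero_left h.symm
  let f : G → ZMod 2 × A := fun g => (χ g, π g)
  have hinj : Function.Injective f := by
    intro g h hgh
    have h1 : χ g = χ h := congrArg Prod.fst hgh
    have h2 : π g = π h := congrArg Prod.snd hgh
    have hk : π (g⁻¹ * h) = 0 := by rw [hπ, hπinv, ← h2, neg_add_cancel]
    rcases hker _ hk with h3 | h3
    · exact inv_mul_eq_one.mp h3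
    · exfalso
      have h4 : χ (g⁻¹ * h) = 1 := by rw [h3, hχc]
      rw [hχ, hχinv, ← h1, neg_add_cancel] at h4
      exact zero_ne_one h4
  have hsurj' : Function.Surjective f := by
    rintro ⟨a, y⟩
    obtain ⟨g, rfl⟩ := hsurj y
    by_cases hga : χ g = a
    · exact ⟨g, Prod.ext hga rfl⟩
    · refine ⟨g * c, Prod.ext ?_ ?_⟩
      · show χ (g * c) = a
        rw [hχ, hχc]
        have h01 : ∀ u v : ZMod 2, u ≠ v → u + 1 = v := by decide
        exact h01 _ _ hga
      · show π (g * c) = π g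
        rw [hπ, hπc, add_zero]
  refine ⟨Equiv.ofBijective f ⟨hinj, hsurj'⟩, fun g h => ?_, ?_⟩
  · show f (g * h) = f g + f h
    simp only [f, hχ, hπ, Prod.mk_add_mk]
  · show f c = (1, 0)
    simp only [f, hχc, hπc]

/-- **Conversely a datum forces `c ∉ G²`**: `ε (r·r) = 2·ε r` has first coordinate `0 ≠ 1`. [folklore] -/
theorem not_isSquare_of_datum {c : G} (ε : G ≃ ZMod 2 × A) (hε : ∀ g h, ε (g * h) = ε g + ε h) (hεc : ε c = (1, 0)) :
    ¬ IsSquare c := by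
  rintro ⟨r, hr⟩
  have h := congrArg Prod.fst (hε r r)
  rw [← hr, hεc, Prod.fst_add] at h
  have h2 : ∀ u : ZMod 2, (1 : ZMod 2) ≠ u + u := by decide
  exact h2 _ h

/-- **The canonical presentation `G → G/⟨c⟩` of a commutative group** (additive notation on the quotient): additive on products,
kills `c`, kernel `{1, c}`, onto. [folklore] -/
theorem presentation_quotient {G : Type*} [CommGroup G] (c : G) (hc2 : c * c = 1) :
    (∀ g h : G, (Additive.ofMul (QuotientGroup.mk (s := Subgroup.zpowers c) (g * h)) : Additive (G ⧸ Subgroup.zpowers c)) =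
        Additive.ofMul (QuotientGroup.mk g) + Additive.ofMul (QuotientGroup.mk h)) ∧
      (Additive.ofMul (QuotientGroup.mk (s := Subgroup.zpowers c) c) : Additive (G ⧸ Subgroup.zpowers c)) = 0 ∧
      (∀ g : G, (Additive.ofMul (QuotientGroup.mk (s := Subgroup.zpowers c) g) : Additive (G ⧸ Subgroup.zpowers c)) = 0 →
        g = 1 ∨ g = c) ∧
      Function.Surjective (fun g : G => (Additive.ofMul (QuotientGroup.mk (s := Subgroup.zpowers c) g) :
        Additive (G ⧸ Subgroup.zpowers c))) := by
  refine ⟨fun g h => rfl, ?_, fun g hg => ?_, ?_⟩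
  · rw [ofMul_eq_zero, QuotientGroup.eq_one_iff]
    exact Subgroup.mem_zpowers c
  · rw [ofMul_eq_zero, QuotientGroup.eq_one_iff] at hg
    exact eq_one_or_eq_of_mem_zpowers hc2 hg
  · intro y
    obtain ⟨g, hg⟩ := QuotientGroup.mk_surjective (Additive.toMul y)
    exact ⟨g, by simp [hg]⟩

/-- **A datum exists iff `c` is a non-square involution** (commutative `G`; the datum onto `ℤ/2 × G/⟨c⟩`). [folklore] -/
theorem exists_datum_iff_not_isSquare {G : Type*} [CommGroup G] (c : G) (hc2 : c * c = 1) :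
    (∃ ε : G ≃ ZMod 2 × Additive (G ⧸ Subgroup.zpowers c), (∀ g h, ε (g * h) = ε g + ε h) ∧ ε c = (1, 0)) ↔ ¬ IsSquare c := by
  constructor
  · rintro ⟨ε, hε, hεc⟩
    exact not_isSquare_of_datum ε hε hεc
  · intro hns
    obtain ⟨χ, hχ⟩ := exists_addChar_of_not_isSquare hns
    obtain ⟨hπ, hπc, hker, hsurj⟩ := presentation_quotient c hc2
    exact exists_datum_of_presentation c (fun g => χ (Additive.ofMul g)) (fun g h => by rw [ofMul_mul, map_add]) hχ _ hπ hπc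
      hker hsurj

end Datum

/-! ## §3 Fields: commutative `Aut(F)`, the conjugation automorphism, cyclotomic fields -/

section Field

variable {F : Type} [Field F] [NumberField F]

/-- **The `Aut`-datum of a number field with commutative automorphism group whose conjugation automorphism `c` is not a square**
(presentation form: `π : Aut(F) ↠ A` any presentation of `Aut(F)/⟨c⟩`): a bijection `ε : Aut(F) ≃ ℤ/2 × A`, multiplicative-to-additive,
with `ε c = (1, 0)` — the input of `autDatum` / `exists_faceSet_oddSliceFamily_aut` / `exists_faceSet_evenSliceSquares_aut`. [folklore] -/
theorem exists_autDatum_of_not_isSquare (hcomm : ∀ g h : F ≃ₐ[ℚ] F, g * h = h * g) {c : F ≃ₐ[ℚ] F} (hns : ¬ IsSquare c)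
    {A : Type*} [AddCommGroup A] (π : (F ≃ₐ[ℚ] F) → A) (hπ : ∀ g h, π (g * h) = π g + π h) (hπc : π c = 0)
    (hker : ∀ g, π g = 0 → g = 1 ∨ g = c) (hsurj : Function.Surjective π) :
    ∃ ε : (F ≃ₐ[ℚ] F) ≃ ZMod 2 × A, (∀ g h, ε (g * h) = ε g + ε h) ∧ ε c = (1, 0) := by
  letI : CommGroup (F ≃ₐ[ℚ] F) := { (inferInstance : Group (F ≃ₐ[ℚ] F)) with mul_comm := hcomm }
  obtain ⟨χ, hχ⟩ := exists_addChar_of_not_isSquare (G := F ≃ₐ[ℚ] F) hns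
  exact exists_datum_of_presentation c (fun g => χ (Additive.ofMul g)) (fun g h => by rw [ofMul_mul, map_add]) hχ π hπ hπc
    hker hsurj

/-- **Degree `2m`, `m` odd: the conjugation automorphism is never a square** (`|Aut(F)| = [F:ℚ]`; no commutativity needed). [folklore] -/
theorem not_isSquare_conjAut_of_odd [IsGalois ℚ F] [IsTotallyComplex F] (σ₀ : F →+* ℂ) {c : F ≃ₐ[ℚ] F}
    (hcσ : σ₀.comp (c : F →+* F) = conjugate σ₀) {m : ℕ} (hm : Odd m) (hF : Module.finrank ℚ F = 2 * m) : ¬ IsSquare c :=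
  not_isSquare_of_odd (FaceCensus.conjAut_mul_self σ₀ hcσ) (FaceCensus.conjAut_ne_one σ₀ hcσ) hm
    (by rw [IsGalois.card_aut_eq_finrank, hF])

variable {n : ℕ} [NeZero n]

/-- **`Aut(ℚ(ζ_N))` is commutative** (`≃* (ℤ/N)ˣ`, Mathlib `IsCyclotomicExtension.autEquivPow`). [cite: Washington1997, Thm. 2.5] -/
theorem aut_mul_comm_of_isCyclotomicExtension [IsCyclotomicExtension {n} ℚ F] (g h : F ≃ₐ[ℚ] F) : g * h = h * g :=
  (IsCyclotomicExtension.autEquivPow F (Polynomial.cyclotomic.irreducible_rat (NeZero.pos n))).injective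
    (by rw [map_mul, map_mul, mul_comm])

/-- **Complex conjugation on a cyclotomic field is `ζ ↦ ζ⁻¹`, i.e. `−1 ∈ (ℤ/N)ˣ`**: for any complex embedding `σ₀` and the automorphism
`c` inducing complex conjugation at `σ₀`, `autEquivPow c = −1`. [cite: Washington1997, Thm. 2.5] -/
theorem autEquivPow_conjAut [IsCyclotomicExtension {n} ℚ F] (σ₀ : F →+* ℂ) {c : F ≃ₐ[ℚ] F}
    (hcσ : σ₀.comp (c : F →+* F) = conjugate σ₀) :
    IsCyclotomicExtension.autEquivPow F (Polynomial.cyclotomic.irreducible_rat (NeZero.pos n)) c = -1 := by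
  set ζ := IsCyclotomicExtension.zeta n ℚ F with hζdef
  have hζ : IsPrimitiveRoot ζ n := IsCyclotomicExtension.zeta_spec n ℚ F
  have hcζ : c ζ = ζ⁻¹ := by
    apply σ₀.injective
    have h1 : σ₀ (c ζ) = starRingEnd ℂ (σ₀ ζ) := by
      have := RingHom.congr_fun hcσ ζ
      simpa [conjugate_coe_eq] using this
    have hnorm : ‖σ₀ ζ‖ = 1 := by
      have hpow : (σ₀ ζ) ^ n = 1 := by rw [← map_pow, hζ.pow_eq_one, map_one]
      exact Complex.norm_eq_one_of_pow_eq_one hpow (NeZero.ne n)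
    rw [h1, map_inv₀, ← Complex.inv_eq_conj hnorm]
  have hspec : ζ ^ ((hζ.autToPow ℚ c : (ZMod n)ˣ) : ZMod n).val = c ζ := hζ.autToPow_spec ℚ c
  rw [hcζ] at hspec
  set u : ZMod n := ((hζ.autToPow ℚ c : (ZMod n)ˣ) : ZMod n) with hu
  have hdvd : n ∣ u.val + 1 := by
    rw [← hζ.pow_eq_one_iff_dvd, pow_succ, hspec, inv_mul_cancel₀ (hζ.ne_zero (NeZero.ne n))]
  have hu1 : u = -1 := by
    have h0 : ((u.val + 1 : ℕ) : ZMod n) = 0 := (ZMod.natCast_eq_zero_iff _ _).mpr hdvd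
    rw [Nat.cast_add, Nat.cast_one, ZMod.natCast_zmod_val] at h0
    exact eq_neg_of_add_eq_zero_left h0
  apply Units.ext
  rw [Units.val_neg, Units.val_one, ← hu1]
  rfl

/-- **`ℚ(ζ_N)`: the conjugation automorphism is a non-square as soon as `−1` is a non-square unit mod `N`** (`∀ r, r·r ≠ −1`, decidable;
true iff `4 ∣ N` or a prime `≡ 3 (mod 4)` divides `N`). [cite: Washington1997, Thm. 2.5] -/
theorem not_isSquare_conjAut_of_isCyclotomicExtension [IsCyclotomicExtension {n} ℚ F] (σ₀ : F →+* ℂ) {c : F ≃ₐ[ℚ] F}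
    (hcσ : σ₀.comp (c : F →+* F) = conjugate σ₀) (hN : ∀ r : (ZMod n)ˣ, r * r ≠ -1) : ¬ IsSquare c := by
  intro hc
  have h := hc.map (IsCyclotomicExtension.autEquivPow F (Polynomial.cyclotomic.irreducible_rat (NeZero.pos n)))
  rw [autEquivPow_conjAut σ₀ hcσ] at h
  obtain ⟨r, hr⟩ := h
  exact hN r hr.symm

/-- **Presentations of `Aut(ℚ(ζ_N))/⟨c⟩` from unit tables.**  A function `t : (ℤ/N)ˣ → A`, additive on products, with `t (−1) = 0`,
kernel `{1, −1}` and onto (for a concrete `N` four `decide`s), composed with `autEquivPow`, presents `Aut(F)/⟨c⟩`. [folklore] -/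
theorem presentation_of_unitTable [IsCyclotomicExtension {n} ℚ F] (σ₀ : F →+* ℂ) {c : F ≃ₐ[ℚ] F}
    (hcσ : σ₀.comp (c : F →+* F) = conjugate σ₀) {A : Type*} [AddCommGroup A] (t : (ZMod n)ˣ → A)
    (ht : ∀ u v, t (u * v) = t u + t v) (ht1 : t (-1) = 0) (htker : ∀ u, t u = 0 → u = 1 ∨ u = -1) (htsurj : Function.Surjective t) :
    let e := IsCyclotomicExtension.autEquivPow F (Polynomial.cyclotomic.irreducible_rat (NeZero.pos n))
    (∀ g h : F ≃ₐ[ℚ] F, t (e (g * h)) = t (e g) + t (e h)) ∧ t (e c) = 0 ∧ (∀ g, t (e g) = 0 → g = 1 ∨ g = c) ∧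
      Function.Surjective (fun g : F ≃ₐ[ℚ] F => t (e g)) := by
  intro e
  have hc : e c = -1 := autEquivPow_conjAut σ₀ hcσ
  refine ⟨fun g h => by rw [map_mul, ht], by rw [hc, ht1], fun g hg => ?_, fun y => ?_⟩
  · rcases htker _ hg with h1 | h1
    · left; exact e.injective (by rw [h1, map_one])
    · right; exact e.injective (by rw [h1, hc])
  · obtain ⟨u, hu⟩ := htsurj y
    exact ⟨e.symm u, by simp only [MulEquiv.apply_symm_apply, hu]⟩

end Field

end Summit.HodgeConjecture.CorCM.FaceAbelian

end
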